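import Summits.PneNP.PneNP.Theses.RamseyUncertifiable
import Literature.Combinatorics.SimpleGraph.LasserreFiniteConvergence
import Literature.Combinatorics.SimpleGraph.LasserreLevelOne
import Literature.Combinatorics.SimpleGraph.LovaszThetaComplement
import Literature.Combinatorics.SimpleGraph.RamseyNumbers

/-!
# Disproof of `SosUncertainty` (stmt-PneNP-9815) — standing adversary file

Crux (route `RamseyUncertifiable`, rank 2), verbatim:
`∀ t ≥ 1, ∃ δ > 0, ∃ n₀, ∀ n ≥ n₀, ∀ G : SimpleGraph (Fin n), n ^ δ ≤ las_t(G) · las_t(Gᶜ)`.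

## Findings (index)

* (a) LOAD-BEARING `1 ≤ t`: `lasserreStableBound_zero` — level `0` is the junk value `0`
  (unbounded program), so the crux with `1 ≤ t` dropped is FALSE:
  `sosUncertainty_false_without_level_pos`.
* (b) TIGHTNESS of the exponent: `lasserreStableBound_top_le_one`, `prod_bot_le_card` — for the
  edgeless graph the product is `≤ n` at every level, so NO level admits `δ > 1`:
  `not_sosUncertainty_superlinear` (the level-1 exponent `δ = 1` of Lovász's `ϑ(G)ϑ(Ḡ) ≥ n`
  cannot be improved anywhere in the hierarchy).
* (c) NATURAL STRENGTHENING refuted — "`δ = 1, n₀ = 1` persists to level 2" is FALSE: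
  `level_two_product_C5_lt` — for the pentagon `las₂(C₅)·las₂(C̄₅) = α·ω = 4 < 5`
  (finite convergence at level `2 ≥ α(C₅) = 2`), so `not_levelTwo_lovaszShape`.
* (d) REDUCTION (the attack surface): `prod_le_indepNum_mul_lovaszTheta` — whenever
  `α(G) ≤ t`, `las_t(G)·las_t(Gᶜ) ≤ α(G)·ϑ(Gᶜ)`; hence `delta_le_of_boundedAlphaFamily`: a
  family with `α ≤ t` and `ϑ(Gᶜ) ≤ C n^γ` infinitely often caps every admissible level-`t`
  exponent at `γ`. With Alon's explicit triangle-free Cayley graphs `H_n` (ϑ(H_n) = Θ(n^{2/3}),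
  Alon 1994) this gives `δ₂ ≤ 2/3 < 1` (`delta_two_le_two_thirds_of_alon`, hypothesis named
  `AlonThetaFamily`, not in the tree) — level 2 is STRICTLY weaker than level 1 in the exponent,
  but bounded-α families can never kill the crux: the other factor is `≥ ω(G) ≥ n^{1/t}/t`
  by Ramsey, consistent with `δ_t ↓ 0`.
  `not_boundedAlphaFamily_of_nonpos` / `inv_le_of_boundedAlphaFamily` (Erdős–Szekeres, tree): such
  families have exponent `γ ≥ 1/t`, so this reduction caps `δ_t` but never kills;
  `not_uniformSosUncertainty_of_families`: Feige-type families for every `ε` would refute the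
  UNIFORM strengthening (one `δ` for all `t`).
* (f) CERTIFICATION TOOL (proved): the conditioning recursion `lasserreStableBound_succ_le_one_add`
  (`las_{t+1}(G) ≤ 1 + max_u las_t(G[N̄(u)])`, level-`t` feasibility of the conditioned vector
  `isLasserreFeasible_condVec`) and its level-2 case `lasserreStableBound_two_le_one_add`
  (`las₂ ≤ 1 + max_u ϑ(link complement)`): the handle any future kill must use, and the premise of
  obstruction (5).
* (g) OBSTRUCTION (5) AT LEVEL 2 (proved): `lovaszTheta_comap_le` (ϑ monotone under induced
  subgraphs) and `card_inter_le_linkTheta_mul`: `|N̄(u) ∩ N(w)| ≤ ϑ(G[N̄ u]) · ϑ(Gᶜ[N w])`, so the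
  level-2 conditioning certificate is `≥ max_{u,w} |N̄(u) ∩ N(w)|`.
* (h) LEVEL-2 CERTIFICATE UP (proved): `card_div_maxDegree_succ_le_lovaszTheta` (theta Caro–Wei,
  `ϑ(F) ≥ n/(Δ+1)` by an explicit feasible matrix) and `levelTwoCertificate_uncertainty`:
  `∃ u w, √n − 1 ≤ (1 + ϑ(G[N̄ u]))(1 + ϑ(Gᶜ[N w]))` for EVERY graph — the level-2 conditioning
  certificate of (f) can never show a product below `√n − 1`.
* (e) WHY IT RESISTS (docstring of `near_miss_franklWilson`): a kill needs ONE fixed level `t₀`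
  certifying `α, ω ≤ n^{ε}` for EVERY `ε` on an explicit weakly-Ramsey family; the natural
  candidates (Frankl–Wilson / Grolmusz) need the modular RW theorem on one side (counting mod p —
  Grigoriev/Tseitin-type obstructions suggest degree growing with p) and p → ∞ for n^{o(1)}.

SMALL-MODEL NUMERICS (uncertified ADMM, other seats' kit jobs, cited): triage r1-2 job j007215 —
`ϑ(C₅) = 2.236`, `las₂(C₅) = 2.000` (matches (c)); `las₂(P_q) = 3.000, 3.000, 4.004 = α(P_q)` for
`q = 13, 17, 29` (level 2 is EXACT on small Paley graphs, so `las₂(P_q)² / q = 9/13, 9/17, 16/29`, exponents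
`0.86, 0.78, 0.82`); `ϑ(P₅[P₅]) = 5`, `ϑ(P₁₃[P₁₃]) = 13` (multiplicativity). This seat's sweep (Paley 37–53,
Clebsch, Schläfli, C₅ products, G(n,½)) is kit job j005417 (queued at the time of writing; its summary
auto-attaches to stmt-PneNP-9815). None of these sizes reaches the asymptotic regime (KY22: `las₂(P_q) ≈
q^{0.456}` only for `q` up to ~1000).

All theorems here are sorry-free unless marked NEAR-MISS.
-/

set_option linter.dupNamespace false

namespace Summit.PneNP.PneNP.Cruxes.SosUncertainty.Disproof

open Literature.Combinatorics.SimpleGraph Finset Matrix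
open Summit.PneNP.PneNP.Theses.RamseyUncertifiable (SosUncertainty)

/-! ## (a) Level 0 is junk: the hypothesis `1 ≤ t` is load-bearing -/

section LevelZero

variable {V : Type*} [Fintype V] [DecidableEq V]

/-- The moment vector `y_∅ = 1`, `y_{v} = c`, `y_S = 0` otherwise. -/
def levelZeroVec (c : ℝ) : Finset V → ℝ := fun S => if S = ∅ then 1 else if S.card = 1 then c else 0

omit [Fintype V] in
theorem levelZeroVec_empty (c : ℝ) : levelZeroVec (V := V) c ∅ = 1 := by simp [levelZeroVec]

omit [Fintype V] in
theorem levelZeroVec_singleton (c : ℝ) (v : V) : levelZeroVec c {v} = c := by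
  simp [levelZeroVec]

/-- At level `0` every `levelZeroVec c` is feasible: `M_0(y) = (y_∅) = (1)`. -/
theorem isLasserreFeasible_zero_levelZeroVec (G : SimpleGraph V) (c : ℝ) :
    IsLasserreFeasible G 0 (levelZeroVec c) := by
  refine ⟨levelZeroVec_empty c, fun u v huv => ?_, ?_⟩
  · have hne : u ≠ v := huv.ne
    simp [levelZeroVec, card_pair hne]
  · have hM : momentMatrix 0 (levelZeroVec (V := V) c) =
        vecMulVec (fun _ : {S : Finset V // S.card ≤ 0} => (1 : ℝ)) (fun _ => 1) := by
      ext I J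
      have hI : I.1 = ∅ := card_eq_zero.1 (Nat.le_zero.1 I.2)
      have hJ : J.1 = ∅ := card_eq_zero.1 (Nat.le_zero.1 J.2)
      simp [momentMatrix_apply, vecMulVec_apply, hI, hJ, levelZeroVec]
    rw [hM]
    have h := posSemidef_vecMulVec_self_star (R := ℝ) (fun _ : {S : Finset V // S.card ≤ 0} => (1 : ℝ))
    rwa [star_trivial] at h

/-- The level-`0` values are unbounded on a nonempty vertex set. -/
theorem not_bddAbove_lasserreValues_zero [Nonempty V] (G : SimpleGraph V) :
    ¬ BddAbove ((fun y : Finset V → ℝ => ∑ v, y {v}) '' {y | IsLasserreFeasible G 0 y}) := by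
  rintro ⟨b, hb⟩
  have hmem : (Fintype.card V : ℝ) * (|b| + 1) ∈
      (fun y : Finset V → ℝ => ∑ v, y {v}) '' {y | IsLasserreFeasible G 0 y} := by
    refine ⟨levelZeroVec (|b| + 1), isLasserreFeasible_zero_levelZeroVec G _, ?_⟩
    simp only [levelZeroVec_singleton, sum_const, card_univ, nsmul_eq_mul]
  have hle := hb hmem
  have hcard : (1 : ℝ) ≤ Fintype.card V := by exact_mod_cast Fintype.card_pos
  have habs : b ≤ |b| := le_abs_self b
  nlinarith [abs_nonneg b]

/-- **Level 0 is the junk value 0** (`sSup` of an unbounded real set). -/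
theorem lasserreStableBound_zero [Nonempty V] (G : SimpleGraph V) : lasserreStableBound G 0 = 0 := by
  rw [lasserreStableBound]
  exact Real.sSup_of_not_bddAbove (not_bddAbove_lasserreValues_zero G)

end LevelZero

/-- The crux with the level hypothesis `1 ≤ t` dropped. -/
def SosUncertaintyWithoutLevelPos : Prop :=
  ∀ t : ℕ, ∃ δ : ℝ, 0 < δ ∧ ∃ n₀ : ℕ, ∀ n ≥ n₀, ∀ G : SimpleGraph (Fin n),
    (n : ℝ) ^ δ ≤ lasserreStableBound G t * lasserreStableBound Gᶜ t

/-- **Any proof must use `1 ≤ t`**: at `t = 0` both factors are the junk value `0` while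
`n ^ δ > 0`. Witness: `t = 0`, `n = n₀ + 1`, `G = ⊥`. -/
theorem sosUncertainty_false_without_level_pos : ¬ SosUncertaintyWithoutLevelPos := by
  intro h
  obtain ⟨δ, _hδ, n₀, hn⟩ := h 0
  have h1 := hn (n₀ + 1) (by omega) ⊥
  rw [lasserreStableBound_zero, zero_mul] at h1
  have h2 : (0 : ℝ) < ((n₀ + 1 : ℕ) : ℝ) ^ δ := Real.rpow_pos_of_pos (by positivity) δ
  linarith

/-! ## (b) Tightness: the exponent can never exceed 1 -/

section Tightness

variable {V : Type} [Fintype V] [DecidableEq V]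

omit [Fintype V] [DecidableEq V] in
/-- `α(K_V) ≤ 1`. -/
theorem indepNum_top_le_one [Finite V] : (⊤ : SimpleGraph V).indepNum ≤ 1 := by
  obtain ⟨s, hs⟩ := (⊤ : SimpleGraph V).exists_isNIndepSet_indepNum
  rw [← hs.card_eq]
  refine card_le_one.2 fun u hu v hv => ?_
  by_contra huv
  exact hs.isIndepSet (mem_coe.2 hu) (mem_coe.2 hv) huv ((SimpleGraph.top_adj u v).2 huv)

/-- `las_t(K_V) ≤ 1` for every `t ≥ 1` (finite convergence at level `t ≥ α = 1`). -/
theorem lasserreStableBound_top_le_one {t : ℕ} (ht : 1 ≤ t) :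
    lasserreStableBound (⊤ : SimpleGraph V) t ≤ 1 := by
  have hα : (⊤ : SimpleGraph V).indepNum ≤ t := indepNum_top_le_one.trans ht
  rw [lasserreStableBound_eq_indepNum Laurent2003_lasserre_exact_of_indepNum_le_holds ⊤ ht hα]
  exact_mod_cast indepNum_top_le_one

/-- For the edgeless graph the product is at most `n` at every level `t ≥ 1`:
`las_t(⊥) · las_t(⊥ᶜ) ≤ n · 1`. -/
theorem prod_bot_le_card {t : ℕ} (ht : 1 ≤ t) :
    lasserreStableBound (⊥ : SimpleGraph V) t * lasserreStableBound (⊥ : SimpleGraph V)ᶜ t ≤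
      Fintype.card V := by
  rw [compl_bot]
  calc lasserreStableBound (⊥ : SimpleGraph V) t * lasserreStableBound (⊤ : SimpleGraph V) t
      ≤ (Fintype.card V : ℝ) * 1 :=
        mul_le_mul (lasserreStableBound_le_card ⊥ t ht) (lasserreStableBound_top_le_one ht)
          (lasserreStableBound_nonneg ⊤ t ht) (Nat.cast_nonneg _)
    _ = Fintype.card V := mul_one _

end Tightness

/-- **No level admits an exponent `δ > 1`** (strengthening refuted; the level-1 exponent of
Lovász's Corollary 2 is optimal throughout the hierarchy). Witness: `G = ⊥` on `Fin n`,
`n = max n₀ 2`, where the product is `≤ n < n ^ δ`. -/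
theorem not_sosUncertainty_superlinear :
    ¬ ∃ t : ℕ, 1 ≤ t ∧ ∃ δ : ℝ, 1 < δ ∧ ∃ n₀ : ℕ, ∀ n ≥ n₀, ∀ G : SimpleGraph (Fin n),
      (n : ℝ) ^ δ ≤ lasserreStableBound G t * lasserreStableBound Gᶜ t := by
  rintro ⟨t, ht, δ, hδ, n₀, hn⟩
  have h1 := hn (max n₀ 2) (le_max_left _ _) ⊥
  have h2 := prod_bot_le_card (V := Fin (max n₀ 2)) ht
  rw [Fintype.card_fin] at h2
  have hgt : (1 : ℝ) < ((max n₀ 2 : ℕ) : ℝ) := by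
    have : (2 : ℕ) ≤ max n₀ 2 := le_max_right _ _
    exact_mod_cast this
  have h3 : ((max n₀ 2 : ℕ) : ℝ) ^ (1 : ℝ) < ((max n₀ 2 : ℕ) : ℝ) ^ δ :=
    Real.rpow_lt_rpow_of_exponent_lt hgt hδ
  rw [Real.rpow_one] at h3
  linarith

/-! ## (c) The Lovász shape `n ≤ las_t(G) las_t(Gᶜ)` (δ = 1, n₀ = 1) already fails at level 2 -/

section Pentagon

/-- The pentagon `C₅` on `Fin 5` (`i ∼ i + 1`). -/
def C5 : SimpleGraph (Fin 5) := SimpleGraph.fromRel fun i j : Fin 5 => j = i + 1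

instance : DecidableRel C5.Adj := by
  unfold C5; infer_instance

/-- Every 3-subset of `Fin 5` contains an edge of `C₅` … -/
theorem C5_three_subset_has_edge :
    ∀ s : Finset (Fin 5), s.card = 3 → ∃ u ∈ s, ∃ v ∈ s, C5.Adj u v := by decide

/-- … and a non-edge between distinct vertices (an edge of `C₅ᶜ`). -/
theorem C5_three_subset_has_nonedge :
    ∀ s : Finset (Fin 5), s.card = 3 → ∃ u ∈ s, ∃ v ∈ s, u ≠ v ∧ ¬ C5.Adj u v := by decide

/-- `α(C₅) ≤ 2`. -/
theorem indepNum_C5_le_two : C5.indepNum ≤ 2 := by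
  obtain ⟨s, hs⟩ := C5.exists_isNIndepSet_indepNum
  rw [← hs.card_eq]
  by_contra hlt
  push Not at hlt
  obtain ⟨u, hus, hucard⟩ := exists_subset_card_eq (show 3 ≤ s.card by omega)
  obtain ⟨a, ha, b, hb, hab⟩ := C5_three_subset_has_edge u hucard
  exact hs.isIndepSet (mem_coe.2 (hus ha)) (mem_coe.2 (hus hb)) hab.ne hab

/-- `α(C₅ᶜ) = ω(C₅) ≤ 2`. -/
theorem indepNum_C5_compl_le_two : C5ᶜ.indepNum ≤ 2 := by
  obtain ⟨s, hs⟩ := C5ᶜ.exists_isNIndepSet_indepNum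
  rw [← hs.card_eq]
  by_contra hlt
  push Not at hlt
  obtain ⟨u, hus, hucard⟩ := exists_subset_card_eq (show 3 ≤ s.card by omega)
  obtain ⟨a, ha, b, hb, hab, hnadj⟩ := C5_three_subset_has_nonedge u hucard
  exact hs.isIndepSet (mem_coe.2 (hus ha)) (mem_coe.2 (hus hb)) hab
    ((SimpleGraph.compl_adj _ _ _).2 ⟨hab, hnadj⟩)

/-- **Level 2 on the pentagon**: `las₂(C₅) · las₂(C₅ᶜ) ≤ 4 < 5 = n` (finite convergence:
`las₂ = α` on both sides since `α(C₅) = ω(C₅) = 2`). At level 1 the product is `ϑ(C₅)² = 5`. -/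
theorem level_two_product_C5_lt :
    lasserreStableBound C5 2 * lasserreStableBound C5ᶜ 2 < ((5 : ℕ) : ℝ) := by
  have h1 : lasserreStableBound C5 2 ≤ 2 := by
    rw [lasserreStableBound_eq_indepNum Laurent2003_lasserre_exact_of_indepNum_le_holds C5
      (by norm_num) indepNum_C5_le_two]
    exact_mod_cast indepNum_C5_le_two
  have h2 : lasserreStableBound C5ᶜ 2 ≤ 2 := by
    rw [lasserreStableBound_eq_indepNum Laurent2003_lasserre_exact_of_indepNum_le_holds C5ᶜ
      (by norm_num) indepNum_C5_compl_le_two]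
    exact_mod_cast indepNum_C5_compl_le_two
  have h0 : 0 ≤ lasserreStableBound C5ᶜ 2 := lasserreStableBound_nonneg _ _ (by norm_num)
  have h0' : 0 ≤ lasserreStableBound C5 2 := lasserreStableBound_nonneg _ _ (by norm_num)
  have : lasserreStableBound C5 2 * lasserreStableBound C5ᶜ 2 ≤ 2 * 2 :=
    mul_le_mul h1 h2 h0 (by norm_num)
  have h5 : ((5 : ℕ) : ℝ) = 5 := by norm_num
  rw [h5]; linarith

end Pentagon

/-- **Strengthening refuted**: Lovász's level-1 shape (`δ = 1`, all `n ≥ 1`) does NOT persist to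
level `2` — "`∀ t ≥ 1, ∀ n ≥ 1, ∀ G, n ≤ las_t(G) las_t(Gᶜ)`" is false (witness `t = 2`,
`G = C₅`). So at level `≥ 2` the `∃ δ < 1` / `∃ n₀` slack in the crux is genuinely used. -/
theorem not_levelTwo_lovaszShape :
    ¬ ∀ t : ℕ, 1 ≤ t → ∀ n ≥ 1, ∀ G : SimpleGraph (Fin n),
      (n : ℝ) ≤ lasserreStableBound G t * lasserreStableBound Gᶜ t := by
  intro h
  have h1 := h 2 (by norm_num) 5 (by norm_num) C5
  have h2 := level_two_product_C5_lt
  linarith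

/-! ## (d) The reduction: bounded `α` makes one factor exact, the other is at most `ϑ` -/

section Reduction

variable {V : Type} [Fintype V] [DecidableEq V]

/-- **Attack surface.** If `α(G) ≤ t` (and `t ≥ 1`) then
`las_t(G) · las_t(Gᶜ) ≤ α(G) · ϑ(Gᶜ)`: the first factor is exact (Laurent 2003, in tree), the
second is below level 1 = Lovász `ϑ`. -/
theorem prod_le_indepNum_mul_lovaszTheta (G : SimpleGraph V) {t : ℕ} (ht : 1 ≤ t)
    (hα : G.indepNum ≤ t) :
    lasserreStableBound G t * lasserreStableBound Gᶜ t ≤ G.indepNum * lovaszTheta Gᶜ := by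
  rw [lasserreStableBound_eq_indepNum Laurent2003_lasserre_exact_of_indepNum_le_holds G ht hα]
  exact mul_le_mul_of_nonneg_left (lasserreStableBound_le_lovaszTheta Gᶜ ht) (Nat.cast_nonneg _)

end Reduction

/-- A **bounded-α, small-ϑ-complement family** at level `t` with exponent `γ`: infinitely many `n`
carry a graph `G` on `Fin n` with `α(G) ≤ t` and `ϑ(Gᶜ) ≤ C · n ^ γ`. -/
def BoundedAlphaFamily (t : ℕ) (γ : ℝ) : Prop :=
  ∃ C : ℝ, ∀ n₀ : ℕ, ∃ n ≥ n₀, ∃ G : SimpleGraph (Fin n),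
    G.indepNum ≤ t ∧ lovaszTheta Gᶜ ≤ C * (n : ℝ) ^ γ

/-- **Exponent cap from a bounded-α family**: if `BoundedAlphaFamily t γ` holds then every `δ`
admissible in the crux at level `t` satisfies `δ ≤ γ`. -/
theorem delta_le_of_boundedAlphaFamily {t : ℕ} (ht : 1 ≤ t) {γ : ℝ}
    (hfam : BoundedAlphaFamily t γ) {δ : ℝ} {n₀ : ℕ}
    (h : ∀ n ≥ n₀, ∀ G : SimpleGraph (Fin n),
      (n : ℝ) ^ δ ≤ lasserreStableBound G t * lasserreStableBound Gᶜ t) : δ ≤ γ := by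
  by_contra hlt
  push Not at hlt
  obtain ⟨C, hC⟩ := hfam
  -- eventually `t * C * n ^ γ < n ^ δ`
  have hev : ∀ᶠ n : ℕ in Filter.atTop, (t : ℝ) * C < (n : ℝ) ^ (δ - γ) :=
    ((tendsto_rpow_atTop (by linarith : 0 < δ - γ)).comp tendsto_natCast_atTop_atTop).eventually_gt_atTop _
  obtain ⟨N, hN⟩ := (hev.and (Filter.eventually_ge_atTop (max n₀ 1))).exists_forall_of_atTop
  obtain ⟨n, hnN, G, hαG, hθ⟩ := hC N
  obtain ⟨hlt', hn1⟩ := hN n hnN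
  have hn₀ : n₀ ≤ n := (le_max_left _ _).trans hn1
  have hnpos : (0 : ℝ) < n := by
    have : 1 ≤ n := (le_max_right _ _).trans hn1
    exact_mod_cast this
  have hmain := (h n hn₀ G).trans (prod_le_indepNum_mul_lovaszTheta G ht hαG)
  -- `α(G) · ϑ(Gᶜ) ≤ t · C · n ^ γ`
  have hθnn : 0 ≤ lovaszTheta Gᶜ := lovaszTheta_nonneg _
  have hup : (G.indepNum : ℝ) * lovaszTheta Gᶜ ≤ t * (C * (n : ℝ) ^ γ) :=
    mul_le_mul (by exact_mod_cast hαG) hθ hθnn (Nat.cast_nonneg _)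
  have hsplit : (n : ℝ) ^ δ = (n : ℝ) ^ (δ - γ) * (n : ℝ) ^ γ := by
    rw [← Real.rpow_add hnpos]; ring_nf
  have hγpos : 0 < (n : ℝ) ^ γ := Real.rpow_pos_of_pos hnpos γ
  have : (n : ℝ) ^ (δ - γ) * (n : ℝ) ^ γ ≤ t * C * (n : ℝ) ^ γ := by
    rw [← hsplit]; linarith
  have := lt_of_le_of_lt this (by nlinarith : t * C * (n : ℝ) ^ γ < (n : ℝ) ^ (δ - γ) * (n : ℝ) ^ γ)
  exact lt_irrefl _ this

/-- **Alon's triangle-free theta family** (N. Alon, *Explicit Ramsey graphs and orthonormal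
labelings*, Electron. J. Combin. 1 (1994) R12, Theorem 1.1/2.x: explicit triangle-free Cayley
graphs `H_n` with `ϑ(H̄_n) = Θ(n^{1/3})`, hence — vertex-transitive, Lovász Thm 8 — `ϑ(H_n) =
n/ϑ(H̄_n) = Θ(n^{2/3})`, with `α(H̄_n) = ω(H_n) = 2`; see Balla–Letzter–Sudakov arXiv:1905.01539 §1.1:
`λ(n, K_3) = Θ(n^{1/3})`, Konyagin's upper bound showing `2/3` is the least exponent reachable through
ANY triangle-free complement, since `ϑ(H) ≥ n/ϑ(H̄) ≥ c·n^{2/3}`). Rendered over the tree's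
`lovaszTheta` with `G := H̄_n`: `α(G) ≤ 2` and `ϑ(Gᶜ) ≤ C n^{2/3}` for infinitely many `n`. NOT in the
tree — a hypothesis here. -/
def AlonThetaFamily : Prop := BoundedAlphaFamily 2 ((2 : ℝ) / 3)

/-- **Level 2 is strictly weaker than level 1 in the exponent** (conditional on Alon 1994):
every `δ` admissible at `t = 2` has `δ ≤ 2/3`. (Bounded-α families cannot go further than
`δ_t ≤ O(1/t)`: the other factor is `≥ ω(G) ≥ n^{1/t}/t` by Ramsey — they never KILL the crux.) -/
theorem delta_two_le_two_thirds_of_alon (hA : AlonThetaFamily) {δ : ℝ} {n₀ : ℕ}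
    (h : ∀ n ≥ n₀, ∀ G : SimpleGraph (Fin n),
      (n : ℝ) ^ δ ≤ lasserreStableBound G 2 * lasserreStableBound Gᶜ 2) : δ ≤ 2 / 3 :=
  delta_le_of_boundedAlphaFamily (by norm_num) hA h

/-- The UNIFORM strengthening of the crux: one exponent `δ > 0` for every level `t`. -/
def UniformSosUncertainty : Prop :=
  ∃ δ : ℝ, 0 < δ ∧ ∀ t : ℕ, 1 ≤ t → ∃ n₀ : ℕ, ∀ n ≥ n₀, ∀ G : SimpleGraph (Fin n),
    (n : ℝ) ^ δ ≤ lasserreStableBound G t * lasserreStableBound Gᶜ t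

/-- **Feige-type families would kill the uniform strengthening.** If for every `ε > 0` some level
`t` carries a bounded-`α` family of exponent `ε` (plausible from Feige 1997 / Alon–Kahale 1998:
`K_{t+1}`-free graphs `H` with `ϑ(H̄) ≥ n^{1 − O(1/log t)}`, which for vertex-transitive `H` gives
`ϑ(H) ≤ n^{O(1/log t)}`; transitivity of Feige's randomized graph products is NOT verified here),
then `UniformSosUncertainty` is false, i.e. `δ_t → 0` is forced. The crux itself (δ depending on
`t`) is untouched. -/
theorem not_uniformSosUncertainty_of_families
    (h : ∀ ε : ℝ, 0 < ε → ∃ t : ℕ, 1 ≤ t ∧ BoundedAlphaFamily t ε) : ¬ UniformSosUncertainty := by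
  rintro ⟨δ, hδ, hU⟩
  obtain ⟨t, ht, hfam⟩ := h (δ / 2) (by linarith)
  obtain ⟨n₀, hn⟩ := hU t ht
  have := delta_le_of_boundedAlphaFamily ht hfam hn
  linarith

/-! ### Bounded-`α` families never kill the crux (Erdős–Szekeres, proved in the tree)

If `α(G) ≤ t` then `G` contains a clique of size `≈ n^{1/t}`, so `ϑ(Gᶜ) ≥ ω(G) → ∞`: the reduction
of section (d) can cap the exponent at best at `1/t`, never at `0`. -/

section Ramsey

variable {V : Type} [Fintype V] [DecidableEq V]

/-- Erdős–Szekeres inside `G` (tree: `exists_clique_or_indep_of_choose_le_card`): if `α(G) ≤ t` and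
`C(a + t, a) ≤ |V|` then `G` has an `(a+1)`-clique, whence `a + 1 ≤ ϑ(Gᶜ)`. -/
theorem succ_le_lovaszTheta_compl_of_indepNum_le (G : SimpleGraph V) {t a : ℕ}
    (hα : G.indepNum ≤ t) (hcard : (a + t).choose a ≤ Fintype.card V) :
    ((a + 1 : ℕ) : ℝ) ≤ lovaszTheta Gᶜ := by
  have h := exists_clique_or_indep_of_choose_le_card G (a + t) a t rfl Finset.univ
    (by rwa [Finset.card_univ])
  rcases h with ⟨T, -, hT⟩ | ⟨T, -, hT⟩
  · exact le_lovaszTheta_compl_of_isNClique hT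
  · exfalso
    have hind : G.IsNIndepSet (t + 1) T := (SimpleGraph.isNClique_compl G).1 hT
    have hle := hind.isIndepSet.card_le_indepNum
    rw [hind.card_eq] at hle
    omega

end Ramsey

/-- **Bounded-`α` families have exponent `γ > 0`** — qualitatively: `BoundedAlphaFamily t γ` is
impossible for `γ ≤ 0` (Ramsey: `α ≤ t` forces `ω ≥ a + 1` once `n ≥ C(a+t, a)`, and `ω ≤ ϑ(Gᶜ)`).
So section (d) can never refute the crux outright; it only caps `δ_t`. -/
theorem not_boundedAlphaFamily_of_nonpos {t : ℕ} {γ : ℝ} (hγ : γ ≤ 0) : ¬ BoundedAlphaFamily t γ := by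
  rintro ⟨C, hC⟩
  set a : ℕ := ⌈C⌉₊ with ha
  obtain ⟨n, hn, G, hαG, hθ⟩ := hC (max 1 ((a + t).choose a))
  have hn1 : 1 ≤ n := (le_max_left _ _).trans hn
  have hchoose : (a + t).choose a ≤ Fintype.card (Fin n) := by
    rw [Fintype.card_fin]; exact (le_max_right _ _).trans hn
  have hlow := succ_le_lovaszTheta_compl_of_indepNum_le G hαG hchoose
  have hnγ : (n : ℝ) ^ γ ≤ 1 := Real.rpow_le_one_of_one_le_of_nonpos (by exact_mod_cast hn1) hγ
  have hnγ0 : 0 ≤ (n : ℝ) ^ γ := Real.rpow_nonneg (Nat.cast_nonneg _) γ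
  have hCa : C ≤ a := Nat.le_ceil C
  have hup : lovaszTheta Gᶜ ≤ (a : ℝ) := by
    rcases le_or_gt 0 C with hC0 | hC0
    · calc lovaszTheta Gᶜ ≤ C * (n : ℝ) ^ γ := hθ
        _ ≤ C * 1 := mul_le_mul_of_nonneg_left hnγ hC0
        _ ≤ a := by linarith
    · have h1 : C * (n : ℝ) ^ γ ≤ 0 := mul_nonpos_of_nonpos_of_nonneg hC0.le hnγ0
      have h2 : (0 : ℝ) ≤ a := Nat.cast_nonneg _
      linarith
  have hfin : ((a + 1 : ℕ) : ℝ) ≤ a := hlow.trans hup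
  push_cast at hfin
  linarith

/-- **Quantitative form**: a bounded-`α` family at level `t ≥ 1` has exponent `γ ≥ 1/t`
(`C(a+t, a) ≤ (a+t)^t`, so `α ≤ t` and `(a+t)^t ≤ n` give `ω ≥ a + 1 ≥ n^{1/t} − t`). Hence the
reduction of section (d) can never cap `δ_t` below `1/t` (and, by Lovász Cor. 2 with Alon–Kahale's
`λ(n, K_{t+1}) = O(n^{1−2/(t+1)})`, i.e. `ϑ(H) ≥ c·n^{2/(t+1)}` for every `K_{t+1}`-free `H`, not below
`2/(t+1)`), consistent with the crux. -/
theorem inv_le_of_boundedAlphaFamily {t : ℕ} (ht : 1 ≤ t) {γ : ℝ} (hfam : BoundedAlphaFamily t γ) :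
    (t : ℝ)⁻¹ ≤ γ := by
  by_contra hlt
  push Not at hlt
  obtain ⟨C, hC⟩ := hfam
  have ht0 : (t : ℝ) ≠ 0 := by exact_mod_cast (show t ≠ 0 by omega)
  have htpos : (0 : ℝ) < t := by exact_mod_cast (show 0 < t by omega)
  -- eventually `2 * max C 0 < n ^ (1/t - γ)` and `2 * (t + 1) < n ^ (1/t)`
  have hev1 : ∀ᶠ n : ℕ in Filter.atTop, 2 * max C 0 < (n : ℝ) ^ ((t : ℝ)⁻¹ - γ) :=
    ((tendsto_rpow_atTop (by linarith : 0 < (t : ℝ)⁻¹ - γ)).comp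
      tendsto_natCast_atTop_atTop).eventually_gt_atTop _
  have hev2 : ∀ᶠ n : ℕ in Filter.atTop, 2 * ((t : ℝ) + 1) < (n : ℝ) ^ ((t : ℝ)⁻¹) :=
    ((tendsto_rpow_atTop (by positivity : 0 < (t : ℝ)⁻¹)).comp
      tendsto_natCast_atTop_atTop).eventually_gt_atTop _
  obtain ⟨N, hN⟩ := ((hev1.and hev2).and (Filter.eventually_ge_atTop 1)).exists_forall_of_atTop
  obtain ⟨n, hnN, G, hαG, hθ⟩ := hC N
  obtain ⟨⟨h1, h2⟩, hn1⟩ := hN n hnN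
  have hnpos : (0 : ℝ) < n := by exact_mod_cast hn1
  set x : ℝ := (n : ℝ) ^ ((t : ℝ)⁻¹) with hx
  have hx0 : 0 ≤ x := Real.rpow_nonneg (Nat.cast_nonneg _) _
  -- `a := ⌊x⌋₊ - t`, so `a + t = ⌊x⌋₊` and `(a + t)^t ≤ x^t = n`
  have htfloor : t ≤ ⌊x⌋₊ := by
    apply Nat.le_floor
    have : (t : ℝ) ≤ 2 * ((t : ℝ) + 1) := by linarith
    exact this.trans h2.le
  set a : ℕ := ⌊x⌋₊ - t with ha
  have hat : a + t = ⌊x⌋₊ := Nat.sub_add_cancel htfloor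
  have hchoose : (a + t).choose a ≤ Fintype.card (Fin n) := by
    rw [Fintype.card_fin, Nat.choose_symm_add, hat]
    have h3 : (⌊x⌋₊ ^ t : ℕ) ≤ n := by
      have h4 : ((⌊x⌋₊ : ℕ) : ℝ) ^ t ≤ x ^ t := pow_le_pow_left₀ (Nat.cast_nonneg _) (Nat.floor_le hx0) t
      rw [hx, Real.rpow_inv_natCast_pow (Nat.cast_nonneg _) (by omega)] at h4
      exact_mod_cast h4
    exact (Nat.choose_le_pow _ _).trans h3
  have hlow := succ_le_lovaszTheta_compl_of_indepNum_le G hαG hchoose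
  -- `a + 1 ≥ x - t`, and `x = n^γ · n^(1/t - γ) > n^γ · 2 max C 0 ≥ 2 C n^γ`; also `x > 2(t+1)`
  have hfl : x < (⌊x⌋₊ : ℕ) + 1 := Nat.lt_floor_add_one x
  have hcast : ((a + 1 : ℕ) : ℝ) = (⌊x⌋₊ : ℕ) - t + 1 := by
    have : ((a + t : ℕ) : ℝ) = (⌊x⌋₊ : ℕ) := by exact_mod_cast hat
    push_cast at this ⊢
    linarith
  have hγpos : 0 < (n : ℝ) ^ γ := Real.rpow_pos_of_pos hnpos γ
  have hsplit : x = (n : ℝ) ^ γ * (n : ℝ) ^ ((t : ℝ)⁻¹ - γ) := by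
    rw [hx, ← Real.rpow_add hnpos]; ring_nf
  have hxbig : 2 * (max C 0 * (n : ℝ) ^ γ) < x := by
    rw [hsplit]
    nlinarith
  have hθ' : lovaszTheta Gᶜ ≤ max C 0 * (n : ℝ) ^ γ :=
    hθ.trans (mul_le_mul_of_nonneg_right (le_max_left _ _) hγpos.le)
  -- combine: x - t < a + 1 ≤ ϑ(Gᶜ) ≤ max C 0 · n^γ < x / 2, and x > 2 (t + 1)
  have : (⌊x⌋₊ : ℕ) - (t : ℝ) + 1 ≤ max C 0 * (n : ℝ) ^ γ := by rw [← hcast]; exact hlow.trans hθ'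
  linarith

/-! ## (f) Certification tool: the conditioning recursion
`las_{t+1}(G) ≤ 1 + max_u las_t(G[N̄(u)])` — what a kill would have to drive to `n^{o(1)}` on both
sides (and cannot, by obstruction (5) of section (e)); at `t = 1` it bounds level 2 by `ϑ` of links. -/

section Conditioning

variable {V : Type} [Fintype V] [DecidableEq V] (G : SimpleGraph V) [DecidableRel G.Adj]

/-- The graph induced by `G` on the non-neighbourhood `N̄(u) = {v ≠ u : ¬ u ∼ v}`. -/
abbrev linkCompl (u : V) : SimpleGraph {v // v ≠ u ∧ ¬ G.Adj u v} :=
  G.comap (Function.Embedding.subtype fun v => v ≠ u ∧ ¬ G.Adj u v)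

/-- Conditioning a moment vector on `x_u = 1`, restricted to `N̄(u)`: `z_S = y_{S ∪ {u}} / y_{u}`. -/
noncomputable def condVec (y : Finset V → ℝ) (u : V)
    (S : Finset {v // v ≠ u ∧ ¬ G.Adj u v}) : ℝ :=
  y (insert u (S.map (Function.Embedding.subtype _))) / y {u}

variable {G}

omit [Fintype V] [DecidableRel G.Adj] in
theorem insert_map_union (u : V) (I J : Finset {v // v ≠ u ∧ ¬ G.Adj u v}) :
    insert u ((I ∪ J).map (Function.Embedding.subtype _)) =
      insert u (I.map (Function.Embedding.subtype _)) ∪ insert u (J.map (Function.Embedding.subtype _)) := by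
  rw [Finset.map_union]
  ext x
  simp only [Finset.mem_insert, Finset.mem_union]
  tauto

omit [DecidableRel G.Adj] in
/-- The conditioned vector is level-`t` feasible for `G[N̄(u)]` whenever `y` is level-`(t+1)`
feasible for `G` (`t ≥ 1`) and `y_u > 0` (`M_t(z)` is `y_u⁻¹` times a principal submatrix of
`M_{t+1}(y)`; the edge condition uses `y_{uab} = 0` for an edge `ab`, a set of size `3 ≤ 2(t+1)`). -/
theorem isLasserreFeasible_condVec {t : ℕ} (ht : 1 ≤ t) {y : Finset V → ℝ}
    (hy : IsLasserreFeasible G (t + 1) y) (u : V) (hu : 0 < y {u}) :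
    IsLasserreFeasible (linkCompl G u) t (condVec G y u) := by
  have hu0 : y {u} ≠ 0 := hu.ne'
  refine ⟨?_, ?_, ?_⟩
  · simp [condVec, hu0]
  · intro a b hab
    have hab' : G.Adj a.1 b.1 := hab
    have hne : a.1 ≠ b.1 := hab'.ne
    simp only [condVec, Finset.map_insert, Finset.map_singleton, Function.Embedding.coe_subtype,
      div_eq_zero_iff]
    left
    apply hy.apply_eq_zero_of_not_isIndepSet
    · calc (insert u ({a.1, b.1} : Finset V)).card ≤ ({a.1, b.1} : Finset V).card + 1 :=
            Finset.card_insert_le _ _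
        _ = 2 + 1 := by rw [card_pair hne]
        _ ≤ 2 * (t + 1) := by omega
    · intro hind
      exact hind (by simp) (by simp) hne hab'
  · set f : {S : Finset {v // v ≠ u ∧ ¬ G.Adj u v} // S.card ≤ t} → {S : Finset V // S.card ≤ t + 1} :=
      fun I => ⟨insert u (I.1.map (Function.Embedding.subtype _)), by
        calc (insert u (I.1.map (Function.Embedding.subtype _))).card
            ≤ (I.1.map (Function.Embedding.subtype _)).card + 1 := Finset.card_insert_le _ _
          _ = I.1.card + 1 := by rw [Finset.card_map]
          _ ≤ t + 1 := by have := I.2; omega⟩ with hf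
    have hM : momentMatrix t (condVec G y u) =
        (y {u})⁻¹ • (momentMatrix (t + 1) y).submatrix f f := by
      ext I J
      simp only [momentMatrix_apply, condVec, Matrix.smul_apply, submatrix_apply, hf, smul_eq_mul,
        div_eq_inv_mul, insert_map_union]
    rw [hM]
    exact (hy.posSemidef.submatrix f).smul (inv_nonneg.2 hu.le)

/-- Row sums of the pair moments are controlled by the link bound:
`Σ_v y_{uv} ≤ y_u · (1 + las_t(G[N̄(u)]))` for level-`(t+1)` feasible `y`, `t ≥ 1`. -/
theorem sum_pair_le_mul {t : ℕ} (ht : 1 ≤ t) {y : Finset V → ℝ}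
    (hy : IsLasserreFeasible G (t + 1) y) (u : V) :
    ∑ v, y {u, v} ≤ y {u} * (1 + lasserreStableBound (linkCompl G u) t) := by
  have hcard1 : ∀ w : V, ({w} : Finset V).card ≤ t + 1 := fun w => by
    rw [card_singleton]; omega
  -- split `Σ_v` into `v = u`, `v ∼ u` (zero terms) and `v ∈ N̄(u)`
  have hsplit : ∑ v, y {u, v} =
      y {u} + ∑ v ∈ univ.filter (fun v => v ≠ u ∧ ¬ G.Adj u v), y {u, v} := by
    rw [← Finset.sum_filter_add_sum_filter_not univ (fun v => v = u)]
    congr 1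
    · rw [Finset.filter_eq' univ u, if_pos (mem_univ u), sum_singleton, pair_eq_singleton]
    · rw [← Finset.sum_filter_add_sum_filter_not (univ.filter fun v => ¬ v = u) (fun v => G.Adj u v)]
      have h0 : ∑ v ∈ (univ.filter fun v => ¬ v = u).filter (fun v => G.Adj u v), y {u, v} = 0 :=
        Finset.sum_eq_zero fun v hv => hy.pair_eq_zero (by simp only [mem_filter] at hv; exact hv.2)
      rw [h0, zero_add, Finset.filter_filter]
  have hlas0 : 0 ≤ lasserreStableBound (linkCompl G u) t := lasserreStableBound_nonneg _ t ht
  rcases (hy.apply_nonneg (hcard1 u)).eq_or_lt with h0 | hpos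
  · -- `y_u = 0`: every pair moment through `u` vanishes
    have hz : ∀ v, y {u, v} = 0 := fun v => by
      have := hy.apply_union_eq_zero (I := {u}) (J := {v}) (hcard1 u) (hcard1 v) h0.symm
      rwa [singleton_union] at this
    simp [hz, ← h0]
  · rw [hsplit]
    have hfeas := isLasserreFeasible_condVec ht hy u hpos
    have hval := hfeas.sum_singleton_le_lasserreStableBound ht
    have hterm : ∀ a : {v // v ≠ u ∧ ¬ G.Adj u v},
        condVec G y u {a} = (y {u})⁻¹ * y {u, a.1} := fun a => by
      simp [condVec, div_eq_inv_mul]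
    simp only [hterm, ← Finset.mul_sum] at hval
    rw [Finset.sum_subtype (univ.filter fun v => v ≠ u ∧ ¬ G.Adj u v)
      (p := fun v => v ≠ u ∧ ¬ G.Adj u v) (fun v => by simp)]
    rw [inv_mul_le_iff₀ hpos] at hval
    linarith

/-- **Conditioning recursion**: `las_{t+1}(G) ≤ 1 + M` whenever every link complement has
`las_t(G[N̄(u)]) ≤ M` (`t ≥ 1`). With `(Σ_v y_v)² ≤ Σ_{u,v} y_{uv}` (level 1) and
`sum_pair_le_mul`. Iterating gives `las_t(G) ≤ (t−1) + max_S ϑ(G[N̄(S)])` over stable `(t−1)`-sets. -/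
theorem lasserreStableBound_succ_le_one_add [Nonempty V] {t : ℕ} (ht : 1 ≤ t) {M : ℝ}
    (hM : ∀ u : V, lasserreStableBound (linkCompl G u) t ≤ M) :
    lasserreStableBound G (t + 1) ≤ 1 + M := by
  have hM0 : 0 ≤ M := by
    obtain ⟨u⟩ := ‹Nonempty V›
    exact (lasserreStableBound_nonneg _ t ht).trans (hM u)
  refine lasserreStableBound_le_of_forall fun y hy => ?_
  set s := ∑ v, y {v} with hs
  have h1 : s ^ 2 ≤ ∑ u, ∑ v, y {u, v} :=
    (hy.of_level_le (by omega)).sq_sum_le_sum_sum_pair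
  have h2 : ∑ u, ∑ v, y {u, v} ≤ ∑ u, y {u} * (1 + M) :=
    Finset.sum_le_sum fun u _ => (sum_pair_le_mul ht hy u).trans
      (mul_le_mul_of_nonneg_left (by linarith [hM u])
        (hy.apply_nonneg (by rw [card_singleton]; omega)))
  rw [← Finset.sum_mul, ← hs] at h2
  by_contra hc
  push Not at hc
  have hs0 : 0 < s := by linarith
  nlinarith [mul_lt_mul_of_pos_left hc hs0]

/-- Level 2 in particular: `las₂(G) ≤ 1 + max_u ϑ(G[N̄(u)])`. -/
theorem lasserreStableBound_two_le_one_add [Nonempty V] {M : ℝ}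
    (hM : ∀ u : V, lovaszTheta (linkCompl G u) ≤ M) : lasserreStableBound G 2 ≤ 1 + M :=
  lasserreStableBound_succ_le_one_add le_rfl fun u =>
    (lasserreStableBound_one_eq_lovaszTheta _).le.trans (hM u)

end Conditioning

/-! ## (g) Obstruction (5) at level 2, formally: link thetas obey an uncertainty principle
`ϑ(G[N̄(u)]) · ϑ(Gᶜ[N(w)]) ≥ |N̄(u) ∩ N(w)|` for all `u, w` — so the level-2 conditioning
certificate `(1 + max_u ϑ(G[N̄ u]))(1 + max_w ϑ(Gᶜ[N w]))` is at least `max_{u,w} |N̄(u) ∩ N(w)|`. -/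

section ThetaMonotone

variable {V W : Type} [Fintype V] [DecidableEq V] [Fintype W] [DecidableEq W]

/-- **`ϑ` is monotone under induced subgraphs**: `ϑ(G.comap f) ≤ ϑ(G)` for injective `f`
(zero-padding `B ↦ Pᵀ B P` of a feasible matrix, `P_{w,v} = [f w = v]`). -/
theorem lovaszTheta_comap_le (G : SimpleGraph V) {f : W → V} (hf : Function.Injective f) :
    lovaszTheta (G.comap f) ≤ lovaszTheta G := by
  rw [lovaszTheta]
  refine Real.sSup_le ?_ (lovaszTheta_nonneg G)
  rintro _ ⟨B, hB, rfl⟩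
  -- the zero-padding of `B`
  set P : Matrix W V ℝ := Matrix.of fun w v => if f w = v then 1 else 0 with hP
  set B' : Matrix V V ℝ := Pᴴ * B * P with hB'
  have hentry : ∀ a b : V, B' a b =
      ∑ w, ∑ w', (if f w = a then (1 : ℝ) else 0) * B w w' * (if f w' = b then 1 else 0) := by
    intro a b
    simp only [hB', hP, Matrix.mul_apply, conjTranspose_apply, of_apply, star_trivial,
      Finset.sum_mul]
    rw [Finset.sum_comm]
  have hdiag : ∀ w w' : W, (∑ a : V, (if f w = a then (1 : ℝ) else 0) * B w w' *
      (if f w' = a then 1 else 0)) = if w = w' then B w w' else 0 := by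
    intro w w'
    rw [Finset.sum_eq_single (f w)]
    · by_cases h : w = w'
      · subst h; simp
      · have : f w' ≠ f w := fun h' => h (hf h').symm
        simp [h, this]
    · intro a _ ha; simp [Ne.symm ha]
    · intro h; exact absurd (mem_univ _) h
  have hfeas : IsThetaFeasible G B' := by
    refine ⟨?_, ?_, ?_⟩
    · exact hB.posSemidef.conjTranspose_mul_mul_same P
    · -- trace
      have htr : B'.trace = ∑ w, B w w := by
        simp only [Matrix.trace, Matrix.diag, hentry]
        rw [Finset.sum_comm]
        refine Finset.sum_congr rfl fun w _ => ?_
        rw [Finset.sum_comm]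
        simp only [hdiag]
        simp
      rw [htr]
      have := hB.trace_eq_one
      simpa [Matrix.trace, Matrix.diag] using this
    · intro a b hab
      rw [hentry]
      refine Finset.sum_eq_zero fun w _ => Finset.sum_eq_zero fun w' _ => ?_
      by_cases ha : f w = a
      · by_cases hb : f w' = b
        · have hadj : (G.comap f).Adj w w' := by
            show G.Adj (f w) (f w'); rw [ha, hb]; exact hab
          simp [hB.apply_eq_zero hadj]
        · simp [hb]
      · simp [ha]
  have key : ∀ w w' : W, (∑ a : V, ∑ b : V,
      (if f w = a then (1 : ℝ) else 0) * B w w' * (if f w' = b then 1 else 0)) = B w w' := by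
    intro w w'
    rw [Finset.sum_eq_single (f w)]
    · rw [Finset.sum_eq_single (f w')]
      · simp
      · intro b _ hb; simp [Ne.symm hb]
      · intro h; exact absurd (mem_univ _) h
    · intro a _ ha; simp [Ne.symm ha]
    · intro h; exact absurd (mem_univ _) h
  have hval : entrySum B' = entrySum B := by
    simp only [entrySum, hentry]
    calc (∑ a : V, ∑ b : V, ∑ w : W, ∑ w' : W,
          (if f w = a then (1 : ℝ) else 0) * B w w' * (if f w' = b then 1 else 0))
        = ∑ a : V, ∑ w : W, ∑ b : V, ∑ w' : W,
          (if f w = a then (1 : ℝ) else 0) * B w w' * (if f w' = b then 1 else 0) :=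
          Finset.sum_congr rfl fun a _ => Finset.sum_comm
      _ = ∑ w : W, ∑ a : V, ∑ b : V, ∑ w' : W,
          (if f w = a then (1 : ℝ) else 0) * B w w' * (if f w' = b then 1 else 0) :=
          Finset.sum_comm
      _ = ∑ w : W, ∑ a : V, ∑ w' : W, ∑ b : V,
          (if f w = a then (1 : ℝ) else 0) * B w w' * (if f w' = b then 1 else 0) :=
          Finset.sum_congr rfl fun w _ => Finset.sum_congr rfl fun a _ => Finset.sum_comm
      _ = ∑ w : W, ∑ w' : W, ∑ a : V, ∑ b : V,
          (if f w = a then (1 : ℝ) else 0) * B w w' * (if f w' = b then 1 else 0) :=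
          Finset.sum_congr rfl fun w _ => Finset.sum_comm
      _ = ∑ w : W, ∑ w' : W, B w w' :=
          Finset.sum_congr rfl fun w _ => Finset.sum_congr rfl fun w' _ => key w w'
  rw [← hval]
  exact le_csSup (bddAbove_thetaValues G) ⟨B', hfeas, rfl⟩

omit [Fintype V] [DecidableEq V] [Fintype W] [DecidableEq W] in
/-- `comap` along an injection commutes with complement. -/
theorem compl_comap_eq (G : SimpleGraph V) {f : W → V} (hf : Function.Injective f) :
    (G.comap f)ᶜ = Gᶜ.comap f := by
  ext a b
  simp only [SimpleGraph.compl_adj, SimpleGraph.comap_adj, hf.ne_iff]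

end ThetaMonotone

section LinkUncertainty

variable {V : Type} [Fintype V] [DecidableEq V] (G : SimpleGraph V) [DecidableRel G.Adj]

/-- **Link thetas obey Lovász's uncertainty principle** (obstruction (5) at level 2): for all
`u, w`, `|N̄(u) ∩ N(w)| ≤ ϑ(G[N̄(u)]) · ϑ(Gᶜ[N(w)])` (note `Gᶜ[N̄_{Gᶜ}(w)] = Gᶜ[N_G(w)]`), by Lovász
Cor. 2 on `X = N̄(u) ∩ N(w)` and monotonicity of `ϑ` under induced subgraphs. Hence the level-2
conditioning certificate of section (f) is `≥ max_{u,w} |N̄(u) ∩ N(w)|`, which is `≥ n^{1−o(1)}`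
on graphs with `α, ω ≤ n^{o(1)}` (supersaturation) — it cannot kill the crux. -/
theorem card_inter_le_linkTheta_mul (u w : V) :
    ((univ.filter fun x => (x ≠ u ∧ ¬ G.Adj u x) ∧ (x ≠ w ∧ ¬ Gᶜ.Adj w x)).card : ℝ) ≤
      lovaszTheta (linkCompl G u) * lovaszTheta (linkCompl Gᶜ w) := by
  set X := univ.filter fun x => (x ≠ u ∧ ¬ G.Adj u x) ∧ (x ≠ w ∧ ¬ Gᶜ.Adj w x) with hX
  have hθ1 : 0 ≤ lovaszTheta (linkCompl G u) := lovaszTheta_nonneg _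
  have hθ2 : 0 ≤ lovaszTheta (linkCompl Gᶜ w) := lovaszTheta_nonneg _
  rcases X.eq_empty_or_nonempty with hXe | hXne
  · rw [hXe, card_empty, Nat.cast_zero]; positivity
  · -- the graph induced on `X`
    haveI : Nonempty {x // x ∈ X} := hXne.coe_sort
    set H : SimpleGraph {x // x ∈ X} := G.comap (fun x => (x : V)) with hH
    have hLov := card_le_lovaszTheta_mul_lovaszTheta_compl H
    rw [Fintype.card_coe] at hLov
    -- inclusions into the two links
    let j₁ : {x // x ∈ X} → {v // v ≠ u ∧ ¬ G.Adj u v} := fun x => ⟨x.1, (mem_filter.1 x.2).2.1⟩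
    let j₂ : {x // x ∈ X} → {v // v ≠ w ∧ ¬ Gᶜ.Adj w v} := fun x => ⟨x.1, (mem_filter.1 x.2).2.2⟩
    have hj₁ : Function.Injective j₁ := fun a b h =>
      Subtype.ext (congrArg (fun x : {v // v ≠ u ∧ ¬ G.Adj u v} => x.1) h)
    have hj₂ : Function.Injective j₂ := fun a b h =>
      Subtype.ext (congrArg (fun x : {v // v ≠ w ∧ ¬ Gᶜ.Adj w v} => x.1) h)
    have hH₁ : H = (linkCompl G u).comap j₁ := by ext a b; rfl
    have hH₂ : Hᶜ = (linkCompl Gᶜ w).comap j₂ := by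
      rw [hH, compl_comap_eq G Subtype.val_injective]; ext a b; rfl
    have h1 : lovaszTheta H ≤ lovaszTheta (linkCompl G u) := by
      rw [hH₁]; exact lovaszTheta_comap_le _ hj₁
    have h2 : lovaszTheta Hᶜ ≤ lovaszTheta (linkCompl Gᶜ w) := by
      rw [hH₂]; exact lovaszTheta_comap_le _ hj₂
    exact hLov.trans (mul_le_mul h1 h2 (lovaszTheta_nonneg _) hθ1)

end LinkUncertainty

/-! ## (h) Level-2 conditioning certificates obey an uncertainty principle with exponent 1/2
For EVERY graph on `n ≥ 1` vertices some pair `u, w` has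
`(1 + ϑ(G[N̄ u])) · (1 + ϑ(Gᶜ[N w])) ≥ √n − 1`; since `las₂ ≤ 1 + max_u ϑ(link)` on both sides
(section (f)), the natural level-2 certificate can never exhibit a product below `√n − 1`. -/

section ThetaDegree

variable {V : Type} [Fintype V] [DecidableEq V]

/-- **Theta Caro–Wei**: `ϑ(F) ≥ n / (Δ(F) + 1)`, by the explicit feasible matrix
`B = (ΔI − A + J) / (n(Δ+1))` (`ΔI − A = (ΔI − D) + L ⪰ 0`, zero on edges, trace 1,
`𝟙ᵀB𝟙 = (nΔ − 2e + n²)/(n(Δ+1)) ≥ n/(Δ+1)`). -/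
theorem card_div_maxDegree_succ_le_lovaszTheta (F : SimpleGraph V) [DecidableRel F.Adj] [Nonempty V] :
    (Fintype.card V : ℝ) / (F.maxDegree + 1) ≤ lovaszTheta F := by
  set n : ℝ := (Fintype.card V : ℝ) with hn
  set Δ : ℝ := (F.maxDegree : ℝ) with hΔ
  have hnpos : 0 < n := by rw [hn]; exact_mod_cast Fintype.card_pos
  have hΔ0 : 0 ≤ Δ := by rw [hΔ]; exact Nat.cast_nonneg _
  set c : ℝ := (n * (Δ + 1))⁻¹ with hc
  have hc0 : 0 ≤ c := by rw [hc]; positivity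
  set A : Matrix V V ℝ := F.adjMatrix ℝ with hA
  set J : Matrix V V ℝ := Matrix.of fun _ _ : V => (1 : ℝ) with hJ
  set B : Matrix V V ℝ := c • (Δ • (1 : Matrix V V ℝ) - A + J) with hB
  -- positivity of `ΔI − A`
  have hdiag : Δ • (1 : Matrix V V ℝ) - F.degMatrix ℝ = Matrix.diagonal fun v => Δ - (F.degree v : ℝ) := by
    ext u v
    by_cases huv : u = v
    · subst huv; simp [SimpleGraph.degMatrix]
    · simp [SimpleGraph.degMatrix, huv]
  have hPSD1 : (Δ • (1 : Matrix V V ℝ) - A).PosSemidef := by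
    have h1 : Δ • (1 : Matrix V V ℝ) - A = (Δ • (1 : Matrix V V ℝ) - F.degMatrix ℝ) + F.lapMatrix ℝ := by
      rw [SimpleGraph.lapMatrix, hA]; abel
    rw [h1, hdiag]
    refine Matrix.PosSemidef.add ?_ (F.posSemidef_lapMatrix ℝ)
    rw [Matrix.posSemidef_diagonal_iff]
    intro v
    have := F.degree_le_maxDegree v
    rw [hΔ, sub_nonneg]; exact_mod_cast this
  have hJpsd : J.PosSemidef := by
    have hJ' : J = vecMulVec (fun _ : V => (1 : ℝ)) (fun _ => 1) := by
      ext u v; simp [hJ, vecMulVec_apply]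
    rw [hJ']
    have h := posSemidef_vecMulVec_self_star (R := ℝ) (fun _ : V => (1 : ℝ))
    rwa [star_trivial] at h
  have hBpsd : B.PosSemidef := (hPSD1.add hJpsd).smul hc0
  -- entries of `B`
  have hBapply : ∀ u v : V, B u v = c * (Δ * (if u = v then 1 else 0) - (if F.Adj u v then 1 else 0) + 1) := by
    intro u v
    simp [hB, hJ, hA, Matrix.one_apply, SimpleGraph.adjMatrix_apply, Matrix.sub_apply]
    ring
  have hfeas : IsThetaFeasible F B := by
    refine ⟨hBpsd, ?_, fun u v huv => ?_⟩
    · -- trace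
      simp only [Matrix.trace, Matrix.diag, hBapply, if_true, SimpleGraph.irrefl, if_false]
      rw [Finset.sum_const, card_univ, nsmul_eq_mul, ← hn, hc]
      field_simp
      ring
    · rw [hBapply, if_neg huv.ne, if_pos huv]; ring
  -- the value
  have hrow : ∀ u : V, ∑ v, (if F.Adj u v then (1 : ℝ) else 0) = F.degree u := by
    intro u
    rw [Finset.sum_boole, ← SimpleGraph.card_neighborFinset_eq_degree, SimpleGraph.neighborFinset_eq_filter]
  have hval : entrySum B = c * (Δ * n - ∑ u, (F.degree u : ℝ) + n * n) := by
    simp only [entrySum, hBapply, ← Finset.mul_sum]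
    congr 1
    simp only [Finset.sum_add_distrib, Finset.sum_sub_distrib, hrow, Finset.sum_const, card_univ,
      nsmul_eq_mul, ← hn, ← Finset.mul_sum]
    have : ∑ u : V, ∑ v : V, (if u = v then (1 : ℝ) else 0) = n := by
      simp [Finset.sum_ite_eq, ← hn]
    rw [this]; ring
  have hdeg : ∑ u, (F.degree u : ℝ) ≤ n * Δ := by
    calc ∑ u, (F.degree u : ℝ) ≤ ∑ _u : V, Δ :=
          Finset.sum_le_sum fun u _ => by rw [hΔ]; exact_mod_cast F.degree_le_maxDegree u
      _ = n * Δ := by rw [Finset.sum_const, card_univ, nsmul_eq_mul, ← hn]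
  have hge : n / (Δ + 1) ≤ entrySum B := by
    rw [hval, hc]
    rw [div_le_iff₀ (by positivity)]
    have h1 : (n * (Δ + 1))⁻¹ * (Δ * n - ∑ u, (F.degree u : ℝ) + n * n) * (Δ + 1)
        = (Δ * n - ∑ u, (F.degree u : ℝ) + n * n) / n := by
      field_simp
    rw [h1, le_div_iff₀ hnpos]
    nlinarith
  exact hge.trans (le_csSup (bddAbove_thetaValues F) ⟨B, hfeas, rfl⟩)

end ThetaDegree

section LevelTwoCertificate

variable {V : Type} [Fintype V] [DecidableEq V] (G : SimpleGraph V) [DecidableRel G.Adj]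

/-- The "escape set" `N(x) ∖ N[u]` = vertices in `N̄(u)` adjacent to `x`. -/
abbrev escape (u x : V) : Finset V := univ.filter fun y => (y ≠ u ∧ ¬ G.Adj u y) ∧ G.Adj x y

/-- Degrees inside the link complement `G[N̄(u)]` are escape-set sizes. -/
theorem degree_linkCompl_le (u : V) (x : {v // v ≠ u ∧ ¬ G.Adj u v}) :
    (linkCompl G u).degree x ≤ (escape G u x.1).card := by
  rw [← SimpleGraph.card_neighborFinset_eq_degree]
  have h : ((linkCompl G u).neighborFinset x).map (Function.Embedding.subtype _) ⊆ escape G u x.1 := by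
    intro y hy
    simp only [Finset.mem_map, SimpleGraph.mem_neighborFinset, Function.Embedding.coe_subtype] at hy
    obtain ⟨a, ha, rfl⟩ := hy
    simp only [escape, mem_filter, mem_univ, true_and]
    exact ⟨a.2, ha⟩
  exact (Finset.card_map _).symm.le.trans (Finset.card_le_card h)

/-- In the complement the roles swap: degrees inside `Gᶜ[N(w)]` are escape-set sizes of `G`. -/
theorem degree_linkCompl_compl_le (w : V) (x : {v // v ≠ w ∧ ¬ Gᶜ.Adj w v}) :
    (linkCompl Gᶜ w).degree x ≤ (escape G x.1 w).card := by
  rw [← SimpleGraph.card_neighborFinset_eq_degree]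
  have h : ((linkCompl Gᶜ w).neighborFinset x).map (Function.Embedding.subtype _) ⊆ escape G x.1 w := by
    intro y hy
    simp only [Finset.mem_map, SimpleGraph.mem_neighborFinset, Function.Embedding.coe_subtype] at hy
    obtain ⟨a, ha, rfl⟩ := hy
    have ha' : Gᶜ.Adj x.1 a.1 := ha
    rw [SimpleGraph.compl_adj] at ha'
    obtain ⟨hne, hnadj⟩ := a.2
    rw [SimpleGraph.compl_adj, not_and, not_not] at hnadj
    simp only [escape, mem_filter, mem_univ, true_and]
    exact ⟨⟨ha'.1.symm, ha'.2⟩, hnadj hne.symm⟩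
  exact (Finset.card_map _).symm.le.trans (Finset.card_le_card h)

/-- The two links at `x` together cover all other vertices: `|N̄(x)| + |N(x)| ≥ n − 1`. -/
theorem card_links_ge [Nonempty V] (x : V) :
    (Fintype.card V : ℝ) - 1 ≤ (Fintype.card {v // v ≠ x ∧ ¬ G.Adj x v} : ℝ) +
      (Fintype.card {v // v ≠ x ∧ ¬ Gᶜ.Adj x v} : ℝ) := by
  rw [Fintype.card_subtype, Fintype.card_subtype]
  have hcov : univ.erase x ⊆ (univ.filter fun v => v ≠ x ∧ ¬ G.Adj x v) ∪
      (univ.filter fun v => v ≠ x ∧ ¬ Gᶜ.Adj x v) := by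
    intro v hv
    rw [mem_erase] at hv
    simp only [mem_union, mem_filter, mem_univ, true_and, SimpleGraph.compl_adj, not_and, not_not]
    by_cases h : G.Adj x v
    · exact Or.inr ⟨hv.1, fun _ => h⟩
    · exact Or.inl ⟨hv.1, h⟩
  have h1 := (Finset.card_le_card hcov).trans (Finset.card_union_le _ _)
  rw [Finset.card_erase_of_mem (mem_univ x), card_univ] at h1
  have h2 : (Fintype.card V : ℝ) - 1 = ((Fintype.card V - 1 : ℕ) : ℝ) := by
    rw [Nat.cast_sub Fintype.card_pos]; simp
  rw [h2]; exact_mod_cast h1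

/-- A link factor is at least `|link| / (m + 1)` once all escape sets have size `≤ m`. -/
theorem link_factor_ge {m : ℕ} (hm : ∀ u x : V, (escape G u x).card ≤ m) (x : V) :
    (Fintype.card {v // v ≠ x ∧ ¬ G.Adj x v} : ℝ) / (m + 1) ≤ lovaszTheta (linkCompl G x) := by
  rcases isEmpty_or_nonempty {v // v ≠ x ∧ ¬ G.Adj x v} with he | hne
  · rw [Fintype.card_eq_zero, Nat.cast_zero, zero_div]; exact lovaszTheta_nonneg _
  · have hΔ : ((linkCompl G x).maxDegree : ℝ) ≤ m := by
      exact_mod_cast (linkCompl G x).maxDegree_le_of_forall_degree_le m fun a =>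
        (degree_linkCompl_le G x a).trans (hm x a.1)
    calc (Fintype.card {v // v ≠ x ∧ ¬ G.Adj x v} : ℝ) / (m + 1)
        ≤ (Fintype.card {v // v ≠ x ∧ ¬ G.Adj x v} : ℝ) / ((linkCompl G x).maxDegree + 1) :=
          div_le_div_of_nonneg_left (Nat.cast_nonneg _) (by positivity) (by linarith)
      _ ≤ lovaszTheta (linkCompl G x) := card_div_maxDegree_succ_le_lovaszTheta _

/-- The same for the complement links. -/
theorem link_factor_compl_ge {m : ℕ} (hm : ∀ u x : V, (escape G u x).card ≤ m) (x : V) :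
    (Fintype.card {v // v ≠ x ∧ ¬ Gᶜ.Adj x v} : ℝ) / (m + 1) ≤ lovaszTheta (linkCompl Gᶜ x) := by
  rcases isEmpty_or_nonempty {v // v ≠ x ∧ ¬ Gᶜ.Adj x v} with he | hne
  · rw [Fintype.card_eq_zero, Nat.cast_zero, zero_div]; exact lovaszTheta_nonneg _
  · have hΔ : ((linkCompl Gᶜ x).maxDegree : ℝ) ≤ m := by
      exact_mod_cast (linkCompl Gᶜ x).maxDegree_le_of_forall_degree_le m fun a =>
        (degree_linkCompl_compl_le G x a).trans (hm a.1 x)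
    calc (Fintype.card {v // v ≠ x ∧ ¬ Gᶜ.Adj x v} : ℝ) / (m + 1)
        ≤ (Fintype.card {v // v ≠ x ∧ ¬ Gᶜ.Adj x v} : ℝ) / ((linkCompl Gᶜ x).maxDegree + 1) :=
          div_le_div_of_nonneg_left (Nat.cast_nonneg _) (by positivity) (by linarith)
      _ ≤ lovaszTheta (linkCompl Gᶜ x) := card_div_maxDegree_succ_le_lovaszTheta _

/-- **Level-2 conditioning certificates obey an uncertainty principle (exponent 1/2).** For
every graph on `n ≥ 1` vertices there are `u, w` with
`√n − 1 ≤ (1 + ϑ(G[N̄ u])) · (1 + ϑ(Gᶜ[N w]))`. Proof: let `m` be the largest escape set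
`|N(x) ∖ N[u]|`; section (g) gives a pair with `ϑ·ϑ ≥ m`, while bounded escape sets make both
links `m`-degenerate in degree, so at any `x`, `(1 + |N̄ x|/(m+1))(1 + |N x|/(m+1)) ≥ 1 + (n−1)/(m+1)`
by theta Caro–Wei; one of the two is `≥ √n − 1`. -/
theorem levelTwoCertificate_uncertainty [Nonempty V] :
    ∃ u w : V, Real.sqrt (Fintype.card V) - 1 ≤
      (1 + lovaszTheta (linkCompl G u)) * (1 + lovaszTheta (linkCompl Gᶜ w)) := by
  set n : ℝ := (Fintype.card V : ℝ) with hn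
  have hn1 : 1 ≤ n := by rw [hn]; exact_mod_cast Fintype.card_pos
  -- the largest escape set
  obtain ⟨⟨u₀, x₀⟩, -, hmax⟩ := Finset.exists_max_image (univ ×ˢ univ : Finset (V × V))
    (fun p => (escape G p.1 p.2).card) ⟨⟨Classical.arbitrary V, Classical.arbitrary V⟩, by simp⟩
  set m : ℕ := (escape G u₀ x₀).card with hm
  have hmall : ∀ u x : V, (escape G u x).card ≤ m := fun u x => hmax ⟨u, x⟩ (by simp)
  have hθ : ∀ (H : SimpleGraph {v // v ≠ u₀ ∧ ¬ G.Adj u₀ v}), 0 ≤ lovaszTheta H := fun H => lovaszTheta_nonneg _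
  by_cases hcase : Real.sqrt n ≤ (m : ℝ) + 1
  · -- the pair (u₀, x₀): ϑ ϑ ≥ m
    refine ⟨u₀, x₀, ?_⟩
    have hg := card_inter_le_linkTheta_mul G u₀ x₀
    have hsame : (univ.filter fun x => (x ≠ u₀ ∧ ¬ G.Adj u₀ x) ∧ (x ≠ x₀ ∧ ¬ Gᶜ.Adj x₀ x)) =
        escape G u₀ x₀ := by
      ext y
      simp only [escape, mem_filter, mem_univ, true_and, SimpleGraph.compl_adj, not_and, not_not]
      constructor
      · rintro ⟨h1, h2, h3⟩; exact ⟨h1, h3 (Ne.symm h2)⟩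
      · rintro ⟨h1, h3⟩; exact ⟨h1, h3.ne.symm, fun _ => h3⟩
    rw [hsame] at hg
    have h1 : 0 ≤ lovaszTheta (linkCompl G u₀) := lovaszTheta_nonneg _
    have h2 : 0 ≤ lovaszTheta (linkCompl Gᶜ x₀) := lovaszTheta_nonneg _
    nlinarith
  · -- any vertex: both links are `m`-degenerate
    push Not at hcase
    refine ⟨x₀, x₀, ?_⟩
    have ha := link_factor_ge G hmall x₀
    have hb := link_factor_compl_ge G hmall x₀
    have hcov := card_links_ge G x₀
    set a : ℝ := (Fintype.card {v // v ≠ x₀ ∧ ¬ G.Adj x₀ v} : ℝ)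
    set b : ℝ := (Fintype.card {v // v ≠ x₀ ∧ ¬ Gᶜ.Adj x₀ v} : ℝ)
    have ha0 : 0 ≤ a := Nat.cast_nonneg _
    have hb0 : 0 ≤ b := Nat.cast_nonneg _
    have hm0 : (0 : ℝ) < m + 1 := by positivity
    -- (1 + a/(m+1))(1 + b/(m+1)) ≥ 1 + (a+b)/(m+1) ≥ 1 + (n-1)/(m+1) > 1 + (n-1)/√n ≥ √n - 1
    have hprod : 1 + (a + b) / (m + 1) ≤
        (1 + lovaszTheta (linkCompl G x₀)) * (1 + lovaszTheta (linkCompl Gᶜ x₀)) := by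
      have h1 : 1 + a / (m + 1) ≤ 1 + lovaszTheta (linkCompl G x₀) := by linarith
      have h2 : 1 + b / (m + 1) ≤ 1 + lovaszTheta (linkCompl Gᶜ x₀) := by linarith
      have h3 : (1 + a / (m + 1)) * (1 + b / (m + 1)) ≤
          (1 + lovaszTheta (linkCompl G x₀)) * (1 + lovaszTheta (linkCompl Gᶜ x₀)) :=
        mul_le_mul h1 h2 (by positivity) (by linarith [lovaszTheta_nonneg (linkCompl G x₀)])
      have h4 : 1 + (a + b) / (m + 1) ≤ (1 + a / (m + 1)) * (1 + b / (m + 1)) := by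
        rw [add_div]
        nlinarith [div_nonneg ha0 hm0.le, div_nonneg hb0 hm0.le]
      exact h4.trans h3
    have hsq : Real.sqrt n * Real.sqrt n = n := Real.mul_self_sqrt (by linarith)
    have hsqpos : 0 < Real.sqrt n := Real.sqrt_pos.2 (by linarith)
    -- (n - 1)/(m + 1) ≥ (n - 1)/√n
    have hstep : (n - 1) / Real.sqrt n ≤ (a + b) / (m + 1) := by
      calc (n - 1) / Real.sqrt n ≤ (n - 1) / (m + 1) :=
            div_le_div_of_nonneg_left (by linarith) hm0 hcase.le
        _ ≤ (a + b) / (m + 1) := div_le_div_of_nonneg_right hcov hm0.le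
    have hfin : Real.sqrt n - 1 ≤ 1 + (n - 1) / Real.sqrt n := by
      rw [div_eq_mul_inv]
      have hinv : Real.sqrt n * (Real.sqrt n)⁻¹ = 1 := mul_inv_cancel₀ hsqpos.ne'
      nlinarith [inv_pos.2 hsqpos, hsq, hinv]
    linarith

end LevelTwoCertificate

/-! ## (e) Near-misses / why it resists -/

/-- NEAR-MISS (not attempted in Lean; recorded for the provers). A KILL of the crux needs a fixed
level `t₀` and graphs `G_n` with `las_{t₀}(G_n) · las_{t₀}(G_nᶜ) ≤ n^{ε}` for EVERY `ε > 0`, i.e.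
degree-`2t₀` SoS certificates of `α, ω ≤ n^{o(1)}` on an explicit weakly-Ramsey family (both `α` and
`ω` must be unbounded: by `inv_le_of_boundedAlphaFamily` a bounded side forces the product above
`n^{1/t₀}/t₀`). Obstructions found:
(1) bounded-`α` families give only `δ_t ≤ O(1/t)` (section (d));
(2) vertex-partition certificates (cover by parts with `α ≤ t`, resp. `ω ≤ t`) give product
`≥ n / R(t+1,t+1)`, since a part of each kind meet in `< R(t+1,t+1)` vertices;
(3) level 1 is exactly tight on vertex-transitive graphs (`ϑϑ̄ = n`, Lovász Thm 8), so for Cayley /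
Frankl–Wilson / Paley candidates everything rests on levels `≥ 2`, where the only analysed explicit
family (Paley, Kunisky–Yu 2022 Thm 1.2, tree fact `kuniskyYu2022_theorem_1_2`) still has product
`≥ c² p^{2/3}`;
(4) for Frankl–Wilson graphs (`(p²−1)`-subsets of `[m]`, `A ∼ B` iff `|A ∩ B| ≡ −1 (mod p)`) the clique
side is the non-modular RW bound — an honest orthonormal-representation / PSD-rank argument is already
level 1 (`ϑ ≤ msr`, Lovász Thm 11), and level 1 provably fails here by (3) — while the coclique side is
the MODULAR Frankl–Wilson theorem (counting `|A ∩ B|` mod `p`), the kind of reasoning for which SoS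
degree grows with the modulus; and `n^{o(1)}` needs `p → ∞`. No fixed-level certificate is in print;
(5) the CONDITIONING strategy — `las_t(G) ≤ 1 + max_v las_{t−1}(G[V ∖ N[v]])` (condition the moment
vector on `x_v = 1`; with `(Σ_u y_u)² ≤ Σ_{u,v} y_{uv}`, tree `sq_sum_le_sum_sum_pair`), iterated down to
`ϑ` of common non-neighbourhoods `N̄(S)` of stable `(t−1)`-sets (and dually `ϑ̄` of common
neighbourhoods `N(T)` of `(t−1)`-cliques) — obeys its own uncertainty principle: by Lovász at level 1
on `X = N̄(S) ∩ N(T)`, `ϑ(G[N̄(S)]) · ϑ(Ḡ[N(T)]) ≥ |N̄(S) ∩ N(T)|`, and Ramsey supersaturation in a graph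
with `α, ω ≤ n^{o(1)}` yields `S, T` with `|N̄(S) ∩ N(T)| ≥ n^{1−o(1)}`; so conditioning certificates
give product `≥ n^{1−o(1)}` on Ramsey graphs and `≥ n^{Ω(1)}` elsewhere — they can never kill.
GATE NOTE: refuters may land only `¬ Theses-decl` theorems under `Theorems/` (dry-run p-none BOUNCED
`theorems.refuter`), so sections (a)–(d) travel as item evidence (this file), not as tree files. -/
theorem near_miss_franklWilson : True := trivial

end Summit.PneNP.PneNP.Cruxes.SosUncertainty.Disproof
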